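import Literature.MathematicalPhysics.QuantumFieldTheory.Balaban1983to89.T3MinimiserStabilityReduction
import Literature.MathematicalPhysics.QuantumFieldTheory.Balaban1983to89.T3PrintedRegularMinimiser
import Literature.MathematicalPhysics.QuantumFieldTheory.Balaban1983to89.T3OrbitAverage
import Literature.MathematicalPhysics.QuantumFieldTheory.Balaban1983to89.B12ContinuousTransportInvariance
import Literature.MathematicalPhysics.QuantumFieldTheory.Balaban1983to89.Node00.CanonicalTransportOfRecord
import HarnessLib

/-!
# LINE g24-1 «GRADIENT × CRUDE LOCALITY» — S2β itself by INTERPOLATING a FIRST-ORDER size modulus against the crude locality modulus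
(ideator `ym-r3-idea-1` g24, lens «control»; crux `stmt-QuantumFields-20520` = `UnitScaleTilt.FluctuationComparisonRegPrIntL`, rung R3 = continuum SU(2) YM₃ on T³)

TARGET (concluded BY NAME, text byte-identical): the PATH-B organ **S2β** `FluctuationPartSmall` of `Lines/runpair_organ.lean` (= the registry's crux_decl,
`Lines/semiclassical_s2beta.lean` v11.4 §2; = `Lines/suptail_split.lean` §1), restated VERBATIM in §0 together with the EXISTING row it is knit with,
**CRUDELOC** `CrudeLocalityCan` (LINE g21-1 `Lines/suptail_split.lean` §1, byte-identical; there ✓`crudeLocality_of_fluctuationPartSmall : S2β → CRUDELOC`).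

THE OBSERVATION.  S2β asks the connected 4-point `Δ²_{b,b′} f`, `f := log ρ + β_K·𝔄^reg_{J,K,ε₀}` (the FULL fluctuation part of a continuous positive window
version `ρ` of the nested law `ν_{K,J}`), to be BOTH small (`φ_J`, `J·φ_J → 0`) AND tree-decaying (`e^{−κ·tdist(b,b′)}`).  The standing table
(registry v11.4 + LINE g21-1) buys both at once, organ by organ: 1L4ᶜ (one-loop 4-points EXIST, are small AND clustered ⟸ EXW, GAP♯, DET-REP-B‴),
H4ᶜ (beyond one loop: small AND clustered — the recorded wall of REP g19-2 ∕ FMIX g20-1: «depth-uniform clustering beyond one loop»), LFR♯ᶜ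
(⟸ TAILSUP × CRUDELOC, g21-1).  But `Δ²_{b,b′} f = [f U − f V] − [f W − f Z]` where `(U,V)` and `(W,Z)` are ONE-BOND pairs at the SAME bond `b`:
the SIZE of a 4-point is controlled by a FIRST-ORDER quantity — the one-bond oscillation of `f` over the window — with NO reference to `b′`, hence
uniformly in the separation and with no locality mechanism at all.  So:
  (size, first order)  `|Δ²_{b,b′} f| ≤ 2·σ_J`            — NEW ROW **GRAD∘** `OneBondOscillationCan`: `|f U − f V| ≤ σ_J` for window fields `U, V` differing
                                                             at one bond; `σ_J` super-polynomially small in the height `J` (mechanism: on the window the classical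
                                                             response `β·Δ_b𝔄_min ≍ p(g_J)²` CANCELS between `log ρ` and `+β𝔄^reg` (the full-fibre classical minimum
                                                             is attained in the regular fibre, [Balaban1985Variational] Thm 1, FIRST order only); what is left is the one-bond response of the fluctuation
                                                             free energy `Φ = log ∫_{good fibre} e^{−β(A−A_min)}`: one loop `∂_bΦ = −½tr(Δ(V)⁻¹∂_bΔ(V)) = O(|F(V)|) = O(θ_J)`
                                                             by gauge covariance (no gauge-invariant local functional is linear in `F` for SU(2)), times the move
                                                             `|U_b − V_b| ≤ 2θ_J`: `σ_J ≍ θ_J²·polylog = γL^{−J}p(g_J)²·polylog`, GEOMETRIC in `J`; beyond one loop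
                                                             a further `g_J²`; the large-field remainder `D = log ρ − log q^{hist}` has window oscillation `≤ τ_J`
                                                             (TAILSUP∘ `WindowOddsSupIntCan`, zero order, INTERIOR window) — LINE g24-2 resolves GRAD∘ ⟸ GRAD¹∘ + TAILSUP∘ at profile `b₀∕c`).
  (locality, crude)    `|Δ²_{b,b′} f| ≤ C_J·e^{−κ₀ d}`      — EXISTING ROW **CRUDELOC** (polynomial `C_J`, classical response ALLOWED, no cancellation, no smallness).
  (knit, PROVED §2)    `|Δ²f| ≤ min(2σ_J, C_J e^{−κ₀d}) ≤ √(2σ_J C_J)·e^{−κ₀d/2}`,  `J·√(2σ_JC_J) → 0`  (`J²σ_JC_J ≤ 2C₀(J+1)^{a+2}σ_J → 0`: polynomial × super-polynomial).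
Hence **S2β ⟸ GRAD∘ ∧ CRUDELOC** (✓`fluctuationPartSmall_of_gradient_split`), and with LINE g24-2: S2β ⟸ {GRAD¹∘, TAILSUP∘, CRUDELOC} — NO second-order
semiclassics (no `λ → ∞` limits, no determinant representation, no fibre gap, no clustering at ANY loop order): the only clustering statement left in
S2β's cone is CRUDELOC, which the cone already owes (g21-1) and which is PROVABLY never harder than S2β.

WHY EASIER ∕ WHY NEW (problem-relative).  The interpolation knit is LINE g21-1's (credited; tools `min_le_sqrt_mul`, `sqrt_exp_neg` copied by text); g21-1
applies it to LFR♯ᶜ with a ZERO-order size row (odds oscillation TAILSUP) and KEEPS 1L4ᶜ ∕ H4ᶜ clustered.  This line applies it ONE ORGAN UP, to S2β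
itself, with a FIRST-order size row: none of the listed lines (g18-1 table, g19-2 REP, g20-1 FMIX∕DIFF, g21-1, g22∕g23 stability letters) has a first-order
(2-point, one-bond) row — every S2β-side row in the registry is second order (4-point) or zero order (odds).  What it buys: H4ᶜ's clustering requirement
(the g19∕g20 wall) and 1L4ᶜ's (T)-clause (existence + clustering of semiclassical 4-point limits) leave S2β's cone; what it costs: CRUDELOC becomes
load-bearing for S2β directly (under the registry it is one of three doors to LFR♯ᶜ).  GRAD∘ ⇏ S2β (no decay), S2β ⇏ GRAD∘ (a function with small
4-points may have large one-bond oscillation: one-plaquette terms), GRAD∘ ⇏ 20520, ⇏ `YM3TorusSU2` (BC2∕BC7 batteries on the card).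
Honest residue: GRAD∘ still contains the first-order classical cancellation on the window (the full-fibre minimum is the regular-fibre minimum `𝔄^reg_min`,
[Balaban1985Variational] Thm 1) and a first-order one-loop estimate uniform in the depth `K − J`; CRUDELOC is XL and unchanged; GRAD∘ is history-free,
hence IMMUNE to the R3-FLIN boundary layer exactly like S2β and CRUDELOC (diagnosis g21 §4).

Sorries = {GRAD∘ `stub_oneBondOscillationCan` (NEW, M–L), CRUDELOC `stub_crudeLocalityCan` (EXISTING row of LINE g21-1, XL)}; 0 elsewhere.
PUBLISHED organ-level line (RULING №36 (3)): NOT registered as the crux item's skeleton.  No summit is proved by a line; `YM3TorusSU2` is NOT proved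
(S1a, 26243, S2α′, O1 stay open, and S2β is proved here only modulo the two rows); `FluctuationComparisonRegPrIntL` (20520) is NOT concluded by
name by this file; nothing of Bałaban's asserted; rung R3 (YM₃ on T³) — NOT d = 4, NOT infinite volume, NOT a mass gap, NOT Clay.
-/

noncomputable section

open MeasureTheory Filter Topology Set
open Literature.MathematicalPhysics.QuantumFieldTheory.Balaban1983to89
open Literature.MathematicalPhysics.QuantumFieldTheory.Balaban1983to89.T3ContinuumYM3Torus
open Literature.MathematicalPhysics.QuantumFieldTheory.Balaban1983to89.T3NestedUnitLaws
open Literature.MathematicalPhysics.QuantumFieldTheory.Balaban1983to89.T3UnitLawDensityEML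
open Literature.MathematicalPhysics.QuantumFieldTheory.Balaban1983to89.T3UnitScaleTilt
open Literature.MathematicalPhysics.QuantumFieldTheory.Balaban1983to89.T3TiltDescent
open Literature.MathematicalPhysics.QuantumFieldTheory.Balaban1983to89.T3PrintedRegularMinimiser
open Literature.MathematicalPhysics.QuantumFieldTheory.Balaban1983to89.T3ConstrainedMinimiser (fibre)
open Literature.MathematicalPhysics.QuantumFieldTheory.Balaban1983to89.T3LevelShift
open Literature.MathematicalPhysics.QuantumFieldTheory.Balaban1983to89.Missing
open Literature.MathematicalPhysics.QuantumFieldTheory.Balaban1983to89.T4Continuum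

namespace Summit.QuantumFields.YangMills.Cruxes.FluctuationComparisonRegPrIntL.RunPairOrgan.GradientSplit

/-! ## §0 The TARGET organ S2β and the EXISTING row CRUDELOC (verbatim, byte-identical) -/

section Rows

/-- **S2β · FLUCTUATION PART SMALL IN 4-POINT CURRENCY** — VERBATIM from the package `Lines/runpair_organ.lean` (= registry `Lines/semiclassical_s2beta.lean`
v11.4 §2 = `Lines/suptail_split.lean` §1; version-free: it quantifies over continuous positive versions `ρ`). [cite: Balaban1985UV3, Thm 2 p.263 and (41) p.266] -/
def FluctuationPartSmall : Prop :=
  ∀ (L : ℕ), ∃ pS : ℝ, ∀ (b₀ p₀ : ℝ), 0 < b₀ → pS ≤ p₀ → 0 < p₀ → ∃ ε₁ : ℝ, 0 < ε₁ ∧ ∀ (ε₀ : ℝ), 0 < ε₀ → ε₀ ≤ ε₁ →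
    ∃ γ₁ : ℝ, 0 < γ₁ ∧ ∃ κ : ℝ, 0 < κ ∧ ∀ (F : T3Family) (γ : ℝ), F.L = L → 0 < γ → γ ≤ γ₁ →
      ∃ (φ : ℕ → ℝ), (∀ J, 0 ≤ φ J) ∧ Tendsto (fun J : ℕ => (J : ℝ) * φ J) atTop (𝓝 0) ∧
        ∀ (ν : ℕ → (j : ℕ) → Measure (GaugeField (F.P j) 0 (Matrix.specialUnitaryGroup (Fin 2) ℂ))),
          (∀ K, ν K K = T4GenFunBounds.gibbsMeasure (F.P K) ((F.scheme ℰp γ).β K)) →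
          (∀ K j, j < K → ν K j = Measure.map (descend F ℰp j) (ν K (j + 1))) →
          ∀ (J K : ℕ) (hJK : J ≤ K) (ρ : GaugeField (F.P J) 0 (Matrix.specialUnitaryGroup (Fin 2) ℂ) → ℝ),
            (∀ U, PlaqSmall (θBal F.L γ b₀ p₀ J) U → 0 < ρ U) →
            ν K J = (fieldMeasure _ _ _).withDensity (fun U => ENNReal.ofReal (ρ U)) →
            ContinuousOn ρ {U | PlaqSmall (θBal F.L γ b₀ p₀ J) U} →
            ∀ (b b' : PBond (F.P J) 0) (U V W Z : GaugeField (F.P J) 0 (Matrix.specialUnitaryGroup (Fin 2) ℂ)),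
              PlaqSmall (θBal F.L γ b₀ p₀ J) U → PlaqSmall (θBal F.L γ b₀ p₀ J) V →
              PlaqSmall (θBal F.L γ b₀ p₀ J) W → PlaqSmall (θBal F.L γ b₀ p₀ J) Z →
              (∀ e, e ≠ b → U e = V e) → (∀ e, e ≠ b' → U e = W e) → (∀ e, e ≠ b' → V e = Z e) → (∀ e, e ≠ b → W e = Z e) →
              |((Real.log (ρ U) + (F.scheme ℰp γ).β K * minActionRegPr F J K hJK ε₀ U)
                  - (Real.log (ρ V) + (F.scheme ℰp γ).β K * minActionRegPr F J K hJK ε₀ V))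
                - ((Real.log (ρ W) + (F.scheme ℰp γ).β K * minActionRegPr F J K hJK ε₀ W)
                  - (Real.log (ρ Z) + (F.scheme ℰp γ).β K * minActionRegPr F J K hJK ε₀ Z))|
                ≤ φ J * Real.exp (-(κ * (b.src.tdist b'.src : ℝ)))

/-- **CRUDELOC · THE FULL FLUCTUATION PART IS QUASI-LOCAL WITH A POLYNOMIAL RESPONSE MODULUS** (`CrudeLocalityCan`) — VERBATIM from LINE g21-1
`Lines/suptail_split.lean` §1 (EXISTING row, byte-identical; there: size XL, S2β ⇒ CRUDELOC PROVED, CRUDELOC ⇏ S2β).  S2β with its modulus clause replaced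
by `(∀ J, 0 ≤ C J) ∧ ∃ a C₀, ∀ J, C J ≤ C₀·(J+1)^a`: κ-clustered 4-points with AT MOST POLYNOMIAL size — the classical response `β_Jθ_J² ≍ p(g_J)²` is
ALLOWED; no semiclassical cancellation; only the tree-decay localization of Bałaban's effective densities read with crude constants.
[cite: Balaban1989LargeFieldII, (1.66)-(1.67) p.376 and (1.95) p.389; Balaban1988Convergent, §2 (2.18)-(2.27); Balaban1985UV3, (41) p.266; Balaban1984PropagatorsI, Thm 1] -/
def CrudeLocalityCan : Prop :=
  ∀ (L : ℕ), ∃ pS : ℝ, ∀ (b₀ p₀ : ℝ), 0 < b₀ → pS ≤ p₀ → 0 < p₀ → ∃ ε₁ : ℝ, 0 < ε₁ ∧ ∀ (ε₀ : ℝ), 0 < ε₀ → ε₀ ≤ ε₁ →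
    ∃ γ₁ : ℝ, 0 < γ₁ ∧ ∃ κ : ℝ, 0 < κ ∧ ∀ (F : T3Family) (γ : ℝ), F.L = L → 0 < γ → γ ≤ γ₁ →
      ∃ (C : ℕ → ℝ), (∀ J, 0 ≤ C J) ∧ (∃ (a : ℕ) (C₀ : ℝ), ∀ J, C J ≤ C₀ * ((J : ℝ) + 1) ^ a) ∧
        ∀ (ν : ℕ → (j : ℕ) → Measure (GaugeField (F.P j) 0 (Matrix.specialUnitaryGroup (Fin 2) ℂ))),
          (∀ K, ν K K = T4GenFunBounds.gibbsMeasure (F.P K) ((F.scheme ℰp γ).β K)) →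
          (∀ K j, j < K → ν K j = Measure.map (descend F ℰp j) (ν K (j + 1))) →
          ∀ (J K : ℕ) (hJK : J ≤ K) (ρ : GaugeField (F.P J) 0 (Matrix.specialUnitaryGroup (Fin 2) ℂ) → ℝ),
            (∀ U, PlaqSmall (θBal F.L γ b₀ p₀ J) U → 0 < ρ U) →
            ν K J = (fieldMeasure _ _ _).withDensity (fun U => ENNReal.ofReal (ρ U)) →
            ContinuousOn ρ {U | PlaqSmall (θBal F.L γ b₀ p₀ J) U} →
            ∀ (b b' : PBond (F.P J) 0) (U V W Z : GaugeField (F.P J) 0 (Matrix.specialUnitaryGroup (Fin 2) ℂ)),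
              PlaqSmall (θBal F.L γ b₀ p₀ J) U → PlaqSmall (θBal F.L γ b₀ p₀ J) V →
              PlaqSmall (θBal F.L γ b₀ p₀ J) W → PlaqSmall (θBal F.L γ b₀ p₀ J) Z →
              (∀ e, e ≠ b → U e = V e) → (∀ e, e ≠ b' → U e = W e) → (∀ e, e ≠ b' → V e = Z e) → (∀ e, e ≠ b → W e = Z e) →
              |((Real.log (ρ U) + (F.scheme ℰp γ).β K * minActionRegPr F J K hJK ε₀ U)
                  - (Real.log (ρ V) + (F.scheme ℰp γ).β K * minActionRegPr F J K hJK ε₀ V))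
                - ((Real.log (ρ W) + (F.scheme ℰp γ).β K * minActionRegPr F J K hJK ε₀ W)
                  - (Real.log (ρ Z) + (F.scheme ℰp γ).β K * minActionRegPr F J K hJK ε₀ Z))|
                ≤ C J * Real.exp (-(κ * (b.src.tdist b'.src : ℝ)))

/-! ## §1 The NEW row: GRAD∘ — first-order size, no second bond, no locality -/

/-- **GRAD∘ · THE FULL FLUCTUATION PART HAS SUPER-POLYNOMIALLY SMALL ONE-BOND OSCILLATION ON THE WINDOW** (`OneBondOscillationCan`; size M–L; NEW in
this line; this line's organ).  S2β's prefix WITHOUT `κ`; for every block size, profile, regularisation parameter and coupling there is a modulus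
`σ : ℕ → ℝ`, `σ ≥ 0`, decaying faster than every power of the height (`(J+1)^a·σ J → 0` for every `a : ℕ`), such that for every system of nested laws,
every run `K`, height `J ≤ K`, every continuous positive window version `ρ` of `ν_{K,J}`, every bond `b` and every two WINDOW fields `U, V` that agree
off `b`:  `|f U − f V| ≤ σ J`,  `f := log ρ + β_K·𝔄^reg_{J,K,ε₀}`.  A FIRST-ORDER (2-point) statement: no second bond, no separation, no tree decay.
Reading ∕ mechanism: on the window the classical one-bond response `β_K·(𝔄_min U − 𝔄_min V) ≍ β_Jθ_J·|U_b − V_b| ≍ p(g_J)²` (LARGE) cancels EXACTLY between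
`log ρ = −β𝔄_min + Φ_all` and `+β𝔄^reg` because the full-fibre classical minimum over a window datum is attained in the regular fibre (`𝔄_min = 𝔄^reg_min`,
[Balaban1985Variational] Thm 1 — used at FIRST order only; no history restriction enters); the remainder is (i) the one-bond response of the fluctuation free energy `Φ(V) = log ∫_{fibre(V)} e^{−β(A − 𝔄_min V)}` (LINE g24-2 splits it as small-history part GRAD¹∘ + odds TAILSUP∘ on the interior window):
at one loop `∂_bΦ = −½·tr(Δ(V)⁻¹∂_bΔ(V))`, a gauge-covariant local functional of the background, hence `O(|F(V)|) = O(θ_J)` on the window (for SU(2) no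
gauge-invariant local functional is linear in the field strength; along the flat directions of T³ the toron potential is a finite-size effect with one-bond
response `O(N_J^{−2})`), times the move `≤ 2θ_J`: `≍ θ_J²·polylog(g_J⁻¹) = γL^{−J}p(g_J)²·polylog` — GEOMETRIC in `J`; beyond one loop a further factor `g_J²`;
the indicator's motion contributes boundary mass `≍ e^{−c·p(g_j)²}×entropy` (tail-small); (ii) the large-field remainder `D = log ρ − log q^{hist}` whose
whole-window oscillation is `≤ τ_J` (TAILSUP of LINE g21-1, zero order).  LINE g24-2 types (i) as GRAD¹∘ and proves GRAD∘ ⟸ GRAD¹∘ ∧ TAILSUP.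
WHY IT MIGHT FAIL: (a) uniformity in the depth `K − J` of the FIRST-order one-loop response needs the renormalised vacuum-polarisation coefficient summed over
the free levels to stay `O(polylog)` (3-d super-renormalisability; the coupling renormalisation `ℰp` must absorb it exactly as in (45)–(47)); (b) the first-order
classical cancellation needs «the classical part of `log ρ` is `−β_K·𝔄^reg_min`», i.e. the FULL-fibre minimum of the Wilson action over a window datum is attained
in the REGULAR fibre `regFibrePr … ε₀` ([Balaban1985Variational] Thm 1: true for small data and `ε₀ ≤ ε₁(L)`; the row's `∃ ε₁` is there for this) — a residual
`β·Δ_b(𝔄^reg_min − 𝔄_min)` of size `p(g_J)²` anywhere on the window kills the row; NO history enters (`f` is history-free), so the R3-FLIN boundary layer of the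
`hist(b₀)`-restricted objects (diagnosis g21 §3–§4: TAILSUP, LFR♯ᶜ, H4ᶜ, 1L4ᶜ(T) EXPOSED on the full window) does NOT touch GRAD∘ — it is IMMUNE exactly like S2β and
CRUDELOC (§4 of the diagnosis: «full law, no history»), and its resolution (LINE g24-2) reads the history-restricted rows on the INTERIOR window `c·b₀` with history `b₀`,
instantiated at `b₀∕c`; (c) versions: `ρ` is pinned on the (open) window by continuity, so the row is exactly as strong as its mechanism.
NOT a consequence of S2β (one-plaquette terms have zero 4-point at distinct bonds and large gradient); does NOT imply S2β (no decay), 20520, or `YM3TorusSU2`.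
[cite: Balaban1985UV3, (41) p.266 and (45)-(47) p.267; Balaban1985Variational, Thm 1 (8)-(10) p.279; Balaban1987RG1, Thm 1 (0.19)-(0.26); Balaban1989LargeFieldII, (1.77)-(1.79) p.383] -/
def OneBondOscillationCan : Prop :=
  ∀ (L : ℕ), ∃ pS : ℝ, ∀ (b₀ p₀ : ℝ), 0 < b₀ → pS ≤ p₀ → 0 < p₀ → ∃ ε₁ : ℝ, 0 < ε₁ ∧ ∀ (ε₀ : ℝ), 0 < ε₀ → ε₀ ≤ ε₁ →
    ∃ γ₁ : ℝ, 0 < γ₁ ∧ ∀ (F : T3Family) (γ : ℝ), F.L = L → 0 < γ → γ ≤ γ₁ →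
      ∃ (σ : ℕ → ℝ), (∀ J, 0 ≤ σ J) ∧ (∀ a : ℕ, Tendsto (fun J : ℕ => ((J : ℝ) + 1) ^ a * σ J) atTop (𝓝 0)) ∧
        ∀ (ν : ℕ → (j : ℕ) → Measure (GaugeField (F.P j) 0 (Matrix.specialUnitaryGroup (Fin 2) ℂ))),
          (∀ K, ν K K = T4GenFunBounds.gibbsMeasure (F.P K) ((F.scheme ℰp γ).β K)) →
          (∀ K j, j < K → ν K j = Measure.map (descend F ℰp j) (ν K (j + 1))) →
          ∀ (J K : ℕ) (hJK : J ≤ K) (ρ : GaugeField (F.P J) 0 (Matrix.specialUnitaryGroup (Fin 2) ℂ) → ℝ),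
            (∀ U, PlaqSmall (θBal F.L γ b₀ p₀ J) U → 0 < ρ U) →
            ν K J = (fieldMeasure _ _ _).withDensity (fun U => ENNReal.ofReal (ρ U)) →
            ContinuousOn ρ {U | PlaqSmall (θBal F.L γ b₀ p₀ J) U} →
            ∀ (b : PBond (F.P J) 0) (U V : GaugeField (F.P J) 0 (Matrix.specialUnitaryGroup (Fin 2) ℂ)),
              PlaqSmall (θBal F.L γ b₀ p₀ J) U → PlaqSmall (θBal F.L γ b₀ p₀ J) V →
              (∀ e, e ≠ b → U e = V e) →
              |(Real.log (ρ U) + (F.scheme ℰp γ).β K * minActionRegPr F J K hJK ε₀ U)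
                  - (Real.log (ρ V) + (F.scheme ℰp γ).β K * minActionRegPr F J K hJK ε₀ V)| ≤ σ J

/-- **GRAD₁∘ · THE FIRST RUNG** (`OneBondOscillationDepthOneCan`): GRAD∘ on the runs `K = J + 1` only — ONE free level above the window, so `log ρ` is
the log-density of the one-step renormalised law and the fluctuation free energy is that of the ONE-STEP constrained fluctuation measure of the tree
(`T3ConstrainedMinimiser.fibre`; the one-step chart ∕ Laplace tools of ✓WREG, KPL-E): a first-order response estimate of a single Gaussian-dominated
integral, no multi-scale bookkeeping.  PROVED below from GRAD∘ (✓`oneBondOscillationDepthOne_of`); stated for the hands as the entry point.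
[cite: Balaban1985UV3, (38)-(41) p.266; Balaban1985Averaging, (10) p.19] -/
def OneBondOscillationDepthOneCan : Prop :=
  ∀ (L : ℕ), ∃ pS : ℝ, ∀ (b₀ p₀ : ℝ), 0 < b₀ → pS ≤ p₀ → 0 < p₀ → ∃ ε₁ : ℝ, 0 < ε₁ ∧ ∀ (ε₀ : ℝ), 0 < ε₀ → ε₀ ≤ ε₁ →
    ∃ γ₁ : ℝ, 0 < γ₁ ∧ ∀ (F : T3Family) (γ : ℝ), F.L = L → 0 < γ → γ ≤ γ₁ →
      ∃ (σ : ℕ → ℝ), (∀ J, 0 ≤ σ J) ∧ (∀ a : ℕ, Tendsto (fun J : ℕ => ((J : ℝ) + 1) ^ a * σ J) atTop (𝓝 0)) ∧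
        ∀ (ν : ℕ → (j : ℕ) → Measure (GaugeField (F.P j) 0 (Matrix.specialUnitaryGroup (Fin 2) ℂ))),
          (∀ K, ν K K = T4GenFunBounds.gibbsMeasure (F.P K) ((F.scheme ℰp γ).β K)) →
          (∀ K j, j < K → ν K j = Measure.map (descend F ℰp j) (ν K (j + 1))) →
          ∀ (J : ℕ) (ρ : GaugeField (F.P J) 0 (Matrix.specialUnitaryGroup (Fin 2) ℂ) → ℝ),
            (∀ U, PlaqSmall (θBal F.L γ b₀ p₀ J) U → 0 < ρ U) →
            ν (J + 1) J = (fieldMeasure _ _ _).withDensity (fun U => ENNReal.ofReal (ρ U)) →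
            ContinuousOn ρ {U | PlaqSmall (θBal F.L γ b₀ p₀ J) U} →
            ∀ (b : PBond (F.P J) 0) (U V : GaugeField (F.P J) 0 (Matrix.specialUnitaryGroup (Fin 2) ℂ)),
              PlaqSmall (θBal F.L γ b₀ p₀ J) U → PlaqSmall (θBal F.L γ b₀ p₀ J) V →
              (∀ e, e ≠ b → U e = V e) →
              |(Real.log (ρ U) + (F.scheme ℰp γ).β (J + 1) * minActionRegPr F J (J + 1) (Nat.le_succ J) ε₀ U)
                  - (Real.log (ρ V) + (F.scheme ℰp γ).β (J + 1) * minActionRegPr F J (J + 1) (Nat.le_succ J) ε₀ V)| ≤ σ J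

/-- GRAD∘ ⇒ GRAD₁∘ (specialisation to `K = J + 1`). [folklore] -/
theorem oneBondOscillationDepthOne_of (h : OneBondOscillationCan) : OneBondOscillationDepthOneCan := by
  intro L
  obtain ⟨pS, H⟩ := h L
  refine ⟨pS, fun b₀ p₀ hb hpS hp => ?_⟩
  obtain ⟨ε₁, hε₁, H⟩ := H b₀ p₀ hb hpS hp
  refine ⟨ε₁, hε₁, fun ε₀ hε₀ hε₀1 => ?_⟩
  obtain ⟨γ₁, hγ₁, H⟩ := H ε₀ hε₀ hε₀1
  refine ⟨γ₁, hγ₁, fun F γ hFL hγ hγle => ?_⟩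
  obtain ⟨σ, hσ0, hσa, H⟩ := H F γ hFL hγ hγle
  exact ⟨σ, hσ0, hσa, fun ν hνK hνd J ρ hρpos hνρ hρcont => H ν hνK hνd J (J + 1) (Nat.le_succ J) ρ hρpos hνρ hρcont⟩

/-- **S2β ⇒ (GRAD∘'s 4-point shadow is automatic) — NOT claimed.**  Recorded instead: GRAD∘ bounds every window 4-point by `2σ_J` uniformly in the
separation (the first-order size half of the knit). [folklore] -/
theorem abs_fourDiff_le_of_oneBond {fU fV fW fZ s : ℝ} (h1 : |fU - fV| ≤ s) (h2 : |fW - fZ| ≤ s) :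
    |(fU - fV) - (fW - fZ)| ≤ 2 * s := by
  have h := abs_sub (fU - fV) (fW - fZ)
  linarith

/-! ## §2 Two one-line tools (by text from LINE g21-1 §2): the interpolation `min ≤ √(·,·)` and `√(e^{−t}) = e^{−t/2}` -/

/-- `min x y ≤ √(x·y)` for `x, y ≥ 0`. [folklore] -/
theorem min_le_sqrt_mul {x y : ℝ} (hx : 0 ≤ x) (hy : 0 ≤ y) : min x y ≤ Real.sqrt (x * y) := by
  rcases le_total x y with h | h
  · rw [min_eq_left h]
    calc x = Real.sqrt (x ^ 2) := (Real.sqrt_sq hx).symm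
      _ ≤ Real.sqrt (x * y) := Real.sqrt_le_sqrt (by nlinarith)
  · rw [min_eq_right h]
    calc y = Real.sqrt (y ^ 2) := (Real.sqrt_sq hy).symm
      _ ≤ Real.sqrt (x * y) := Real.sqrt_le_sqrt (by nlinarith)

/-- `√(e^{−t}) = e^{−t/2}`. [folklore] -/
theorem sqrt_exp_neg (t : ℝ) : Real.sqrt (Real.exp (-t)) = Real.exp (-(t / 2)) := by
  have h : Real.exp (-t) = Real.exp (-(t / 2)) ^ 2 := by
    rw [sq, ← Real.exp_add]; ring_nf
  rw [h, Real.sqrt_sq (Real.exp_pos _).le]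

/-! ## §3 PROVED: GRAD∘ → CRUDELOC → S2β (the interpolation knit, first-order size half) -/

/-- The implication this line certifies, as ONE named proposition: GRAD∘ → CRUDELOC → S2β. -/
def SplitSuffices : Prop := OneBondOscillationCan → CrudeLocalityCan → FluctuationPartSmall

/-- **COMPOSITION · GRAD∘ → CRUDELOC → S2β (PROVED).**  Thresholds merged by `max`∕`min`; `κ := κ₀/2`; `φ J := √(2·σ J·C J)`;
`J·φ J → 0` from `J²·2σ_J·C_J ≤ 2C₀(J+1)^{a+2}σ_J → 0`; pointwise `|Δ²f| ≤ min(C_J e^{−κ₀d}, 2σ_J) ≤ √(2σ_JC_J)·e^{−κ₀d/2}`.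
[cite: Balaban1985UV3, (41) p.266] -/
theorem fluctuationPartSmall_of_gradient_split : SplitSuffices := by
  intro hG hC L
  obtain ⟨pS₁, H1⟩ := hG L
  obtain ⟨pS₂, H2⟩ := hC L
  refine ⟨max pS₁ pS₂, fun b₀ p₀ hb hpS hp => ?_⟩
  have hp1 : pS₁ ≤ p₀ := (le_max_left _ _).trans hpS
  have hp2 : pS₂ ≤ p₀ := (le_max_right _ _).trans hpS
  obtain ⟨ε₁, hε₁, H1⟩ := H1 b₀ p₀ hb hp1 hp
  obtain ⟨ε₂, hε₂, H2⟩ := H2 b₀ p₀ hb hp2 hp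
  refine ⟨min ε₁ ε₂, lt_min hε₁ hε₂, fun ε₀ hε₀ hε₀1 => ?_⟩
  obtain ⟨γ₁, hγ₁, H1⟩ := H1 ε₀ hε₀ (hε₀1.trans (min_le_left _ _))
  obtain ⟨γ₂, hγ₂, κ₀, hκ₀, H2⟩ := H2 ε₀ hε₀ (hε₀1.trans (min_le_right _ _))
  refine ⟨min γ₁ γ₂, lt_min hγ₁ hγ₂, κ₀ / 2, half_pos hκ₀, fun F γ hFL hγ hγle => ?_⟩
  obtain ⟨σ, hσ0, hσa, H1⟩ := H1 F γ hFL hγ (hγle.trans (min_le_left _ _))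
  obtain ⟨C, hC0, hCpoly, H2⟩ := H2 F γ hFL hγ (hγle.trans (min_le_right _ _))
  refine ⟨fun J => Real.sqrt (2 * σ J * C J), fun J => Real.sqrt_nonneg _, ?_, ?_⟩
  · -- `J·φ J → 0`: polynomial × super-polynomial
    have hCσ : Tendsto (fun J : ℕ => (J : ℝ) ^ 2 * (2 * σ J * C J)) atTop (𝓝 0) := by
      obtain ⟨a, C₀, hCle⟩ := hCpoly
      have h2 : Tendsto (fun J : ℕ => (2 * C₀) * (((J : ℝ) + 1) ^ (a + 2) * σ J)) atTop (𝓝 0) := by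
        have := (hσa (a + 2)).const_mul (2 * C₀)
        rwa [mul_zero] at this
      refine squeeze_zero (fun J => ?_) (fun J => ?_) h2
      · have := hC0 J; have := hσ0 J; positivity
      · have hJ1 : (J : ℝ) ^ 2 ≤ ((J : ℝ) + 1) ^ 2 := by nlinarith [Nat.cast_nonneg (α := ℝ) J]
        have hstep : (J : ℝ) ^ 2 * (C J * σ J) ≤ ((J : ℝ) + 1) ^ 2 * (C₀ * ((J : ℝ) + 1) ^ a * σ J) :=
          mul_le_mul hJ1 (mul_le_mul_of_nonneg_right (hCle J) (hσ0 J)) (mul_nonneg (hC0 J) (hσ0 J)) (by positivity)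
        calc (J : ℝ) ^ 2 * (2 * σ J * C J) = 2 * ((J : ℝ) ^ 2 * (C J * σ J)) := by ring
          _ ≤ 2 * (((J : ℝ) + 1) ^ 2 * (C₀ * ((J : ℝ) + 1) ^ a * σ J)) := by linarith
          _ = (2 * C₀) * (((J : ℝ) + 1) ^ (a + 2) * σ J) := by ring
    have h := hCσ.sqrt
    rw [Real.sqrt_zero] at h
    refine h.congr' (Eventually.of_forall fun J => ?_)
    show Real.sqrt ((J : ℝ) ^ 2 * (2 * σ J * C J)) = (J : ℝ) * Real.sqrt (2 * σ J * C J)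
    rw [Real.sqrt_mul (sq_nonneg _), Real.sqrt_sq (Nat.cast_nonneg J)]
  · intro ν hνK hνd J K hJK ρ hρpos hνρ hρcont b b' U V W Z hU hV hW hZ hUV hUW hVZ hWZ
    have hl := H2 ν hνK hνd J K hJK ρ hρpos hνρ hρcont b b' U V W Z hU hV hW hZ hUV hUW hVZ hWZ
    have h1 := H1 ν hνK hνd J K hJK ρ hρpos hνρ hρcont b U V hU hV hUV
    have h2 := H1 ν hνK hνd J K hJK ρ hρpos hνρ hρcont b W Z hW hZ hWZ
    set B : GaugeField (F.P J) 0 (Matrix.specialUnitaryGroup (Fin 2) ℂ) → ℝ :=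
      fun U => (F.scheme ℰp γ).β K * minActionRegPr F J K hJK ε₀ U with hB
    set d : ℝ := (b.src.tdist b'.src : ℝ) with hd
    have hd0 : 0 ≤ d := by rw [hd]; exact Nat.cast_nonneg _
    have hσJ := hσ0 J
    have hCJ := hC0 J
    -- SIZE WITHOUT LOCALITY (first order): two one-bond oscillations at the bond `b`
    have hy : |((Real.log (ρ U) + B U) - (Real.log (ρ V) + B V)) - ((Real.log (ρ W) + B W) - (Real.log (ρ Z) + B Z))| ≤ 2 * σ J :=
      abs_fourDiff_le_of_oneBond h1 h2
    -- LOCALITY WITHOUT SIZE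
    have hx : |((Real.log (ρ U) + B U) - (Real.log (ρ V) + B V)) - ((Real.log (ρ W) + B W) - (Real.log (ρ Z) + B Z))|
        ≤ C J * Real.exp (-(κ₀ * d)) := hl
    have hx0 : 0 ≤ C J * Real.exp (-(κ₀ * d)) := by positivity
    have hprod : 0 ≤ 2 * σ J * C J := by positivity
    -- KNIT: min ≤ geometric mean
    show |((Real.log (ρ U) + B U) - (Real.log (ρ V) + B V)) - ((Real.log (ρ W) + B W) - (Real.log (ρ Z) + B Z))|
        ≤ Real.sqrt (2 * σ J * C J) * Real.exp (-(κ₀ / 2 * d))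
    calc |((Real.log (ρ U) + B U) - (Real.log (ρ V) + B V)) - ((Real.log (ρ W) + B W) - (Real.log (ρ Z) + B Z))|
          ≤ min (C J * Real.exp (-(κ₀ * d))) (2 * σ J) := le_min hx hy
      _ ≤ Real.sqrt ((C J * Real.exp (-(κ₀ * d))) * (2 * σ J)) := min_le_sqrt_mul hx0 (by positivity)
      _ = Real.sqrt ((2 * σ J * C J) * Real.exp (-(κ₀ * d))) := by congr 1; ring
      _ = Real.sqrt (2 * σ J * C J) * Real.sqrt (Real.exp (-(κ₀ * d))) := Real.sqrt_mul hprod _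
      _ = Real.sqrt (2 * σ J * C J) * Real.exp (-(κ₀ / 2 * d)) := by
          rw [sqrt_exp_neg, show -(κ₀ * d / 2) = -(κ₀ / 2 * d) by ring]

/-- **CRUDELOC IS NEVER HARDER THAN THE TARGET** (by text from LINE g21-1 §1, ✓there): S2β ⇒ CRUDELOC — a modulus with `J·φ J → 0` is bounded, i.e.
polynomial of exponent `0`.  Recorded so that the knit's locality row is certified to lie BELOW S2β. [cite: Balaban1985UV3, (41) p.266] -/
theorem crudeLocality_of_fluctuationPartSmall (h : FluctuationPartSmall) : CrudeLocalityCan := by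
  intro L
  obtain ⟨pS, H⟩ := h L
  refine ⟨pS, fun b₀ p₀ hb hpS hp => ?_⟩
  obtain ⟨ε₁, hε₁, H⟩ := H b₀ p₀ hb hpS hp
  refine ⟨ε₁, hε₁, fun ε₀ hε₀ hε₀1 => ?_⟩
  obtain ⟨γ₁, hγ₁, κ, hκ, H⟩ := H ε₀ hε₀ hε₀1
  refine ⟨γ₁, hγ₁, κ, hκ, fun F γ hFL hγ hγle => ?_⟩
  obtain ⟨φ, hφ0, hφt, H⟩ := H F γ hFL hγ hγle
  have hev : ∀ᶠ J : ℕ in atTop, (J : ℝ) * φ J < 1 := (tendsto_order.1 hφt).2 1 one_pos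
  obtain ⟨J₀, hJ₀⟩ := eventually_atTop.1 hev
  have hbdd : ∀ J, φ J ≤ (∑ i ∈ Finset.range (J₀ + 1), φ i) + 1 := by
    intro J
    rcases le_or_gt J J₀ with hJ | hJ
    · have : φ J ≤ ∑ i ∈ Finset.range (J₀ + 1), φ i :=
        Finset.single_le_sum (fun i _ => hφ0 i) (Finset.mem_range.2 (Nat.lt_succ_of_le hJ))
      linarith
    · have h1 : (J : ℝ) * φ J < 1 := hJ₀ J hJ.le
      have hJ1 : (1 : ℝ) ≤ (J : ℝ) := by exact_mod_cast Nat.succ_le_of_lt (lt_of_le_of_lt (Nat.zero_le _) hJ)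
      have h2 : φ J ≤ (J : ℝ) * φ J := by nlinarith [hφ0 J]
      have hsum0 : 0 ≤ ∑ i ∈ Finset.range (J₀ + 1), φ i := Finset.sum_nonneg fun i _ => hφ0 i
      linarith
  exact ⟨φ, hφ0, ⟨0, (∑ i ∈ Finset.range (J₀ + 1), φ i) + 1, fun J => by simpa using hbdd J⟩, H⟩

end Rows

/-! ## §4 Stubs (the rows' sorries) and the S2β this file delivers -/

section Stubs

/-- GRAD∘ — NEW (size M–L; this line's organ): super-polynomially small one-bond oscillation of the full fluctuation part on the window.
[cite: Balaban1985UV3, (41) and (45)-(47) pp.266-267; Balaban1987RG1, Thm 1 (0.19)-(0.26)] -/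
theorem stub_oneBondOscillationCan : OneBondOscillationCan := by
  sorry

/-- CRUDELOC — EXISTING row of LINE g21-1 `Lines/suptail_split.lean` (size XL), byte-identical text; not a row of this line's own.
[cite: Balaban1989LargeFieldII, (1.66)-(1.67) p.376; Balaban1988Convergent, §2 (2.18)-(2.27)] -/
theorem stub_crudeLocalityCan : CrudeLocalityCan := by
  sorry

/-- GRAD₁∘ for the hands, from the GRAD∘ stub. -/
theorem stub_oneBondOscillationDepthOneCan : OneBondOscillationDepthOneCan := oneBondOscillationDepthOne_of stub_oneBondOscillationCan

/-- **THE S2β THIS FILE DELIVERS** (modulo its two sorries: the NEW first-order row GRAD∘ and the EXISTING row CRUDELOC of LINE g21-1). -/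
theorem fluctuationPartSmall_of_stubs : FluctuationPartSmall :=
  fluctuationPartSmall_of_gradient_split stub_oneBondOscillationCan stub_crudeLocalityCan

end Stubs

end Summit.QuantumFields.YangMills.Cruxes.FluctuationComparisonRegPrIntL.RunPairOrgan.GradientSplit
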